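import Summits.ValiantsHypothesis.ValiantsHypothesis.Theorems.FifoMatchingNNDivisionHardExactPencilPairsRead
import HarnessLib

/-!
# EXACT PENCILS XII — ★★★ the dead-set RATE (`cor_add_touchOrSparse_decided`), COLUMN-HIT passengers (every `≤ √(n/2)`-vertex passenger; `COR(n) + CUT(n)`), FUNCTION-GRAPH passengers (`PM(K_n)`, Birkhoff vertices) (crux `NNDivisionHard`, stmt-ValiantsHypothesis-21181) — `ExactPencil` port part 12/12

Theorems-side port (staged by val-idea-40 g6, C′-census owner per director-valiant R331 (2)(e) / desk #399, for the port hands;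
press as `Theorems/FifoMatchingNNDivisionHardExactPencilColumnHit.lean`, `--kind proof --supports stmt-ValiantsHypothesis-21181 --as helper`; sig-first val-idea-crit-9 g3) of
§12f, §12g and §12h of val-idea-38 g2's crux workfile `Cruxes/NNDivisionHard/ExactPencil38.lean` REV 16 @4e81d1716f6b (sha16 d9f2e288279a0b09, 3 456 l., FROZEN — final from 38 g2, bus 01:14:51Z; critic of record val-idea-crit-9 g2/g3: `CRITIC-wave6.md` FINAL + V#97 §2 «rev 14/15 δ KERNEL VERIFIED»).  Declaration texts VERBATIM (namespace
`…Theorems.FifoMatching.ExactPencil`; one-line docstrings added where the source had none); the 40-g5 tools the source RESTATED are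
DROPPED here and cited BY NAME from the landed ports `…Theorems.FifoMatching.LocatedRows.*` (✓ p680125 … p683387: `T`, `RowFamily`,
`hCOR`, `exactTilted`, `ExactPencilLaw`, `pinnedRows`, `unflat`, `three_pow_le_of_block`, `two_pow_half_mul_le`, `zgen`, `cubePt`, …) and
`…Theorems.FifoMatching.XcDivision` (`udRow`, `udPt`, `udInd`, `udMat`, …), so that C′ stays ONE Theorems declaration
`LocatedRows.ExactPencilLaw`.  Part 12/12 of the port (imports part 11, `…Theorems.FifoMatchingNNDivisionHardExactPencilPairsRead`).

* §12f `three_two_pow_mono`, ★★★ `cor_add_touchOrSparse_decided` (`2|Z| ≤ n/s`: `T c n < r` eventually);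
* §12g ★★★ `cor_add_bound_of_columnHit` (`Z ∋` a nonzero column of every nonzero pairwise difference ⟹ `3^{n−|Z|} ≤ (r+1)·2^{n−|Z|}`), ★★★ `cor_add_columnHit_decided`,
  ★★★ `cor_add_fewVertex_decided` (EVERY passenger with `2·|ι|² ≤ n` vertices, any shape), `cutMat`, `cutMat_eq_of_column`, ★★★ `cor_add_cut_bound` (`COR(n) + CUT(n)`: `3^{n−1} ≤ (r+1)·2^{n−1}`);
* §12h `graphMat`, `exists_faceZero_reads_graphMat`, ★★★ `cor_add_funcGraph_bound`, ★★★ `cor_add_funcGraph_decided` (perfect matchings, permutation / assignment vertices, any subfamily).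

HONEST LABEL: every theorem here is a DECIDED SPECIES / support lemma for the OPEN law C′ = `LocatedRows.ExactPencilLaw`
(`exactTilted.Law`); the crux 21181 `NNDivisionHard`, C′, `allRows.Law` and COR-VIRTUAL are OPEN; C⁺_entry `LocatedPencilLaw` is
REFUTED (✓ p679540).  VP ≠ VNP is NOT proved here or anywhere in this tree.
-/

set_option autoImplicit false

-- the mandated summit-side namespace repeats a component by design (single-problem summit)
set_option linter.dupNamespace false

noncomputable section

open Matrix Finset
open scoped Pointwise

namespace Summit.ValiantsHypothesis.ValiantsHypothesis.Theorems.FifoMatching.ExactPencil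

open Literature.Barriers.PneNP (HasEFOfSize three_pow_le_card_mul_two_pow_of_cover_univ)
open Literature.Combinatorics.Optimization.FixedSizePsdRank
  (corPolytope flat vecOuter flat_dotProduct_le_of_mem_corPolytope flat_dotProduct_vecOuter)
open Summit.ValiantsHypothesis.ValiantsHypothesis.Theorems.FifoMatching.XcDivision
  (udRow udPt udInd udMat ud_data udInd_apply udInd_sq dot_le_of_mem_convexHull flat_dotProduct_flat)
open Summit.ValiantsHypothesis.ValiantsHypothesis.Theorems.FifoMatching.LocatedRows
  (T CorVirtualHardN RowFamily corVirtualHardN_of_law flat_le_box entryTilted allRows LocatedPencilLaw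
    hCOR le_hCOR exists_eq_hCOR flat_le_hCOR hCOR_le_box exactTilted ExactPencilLaw exactTilted_emb_allRows
    corVirtualHardN_of_exactPencilLaw three_pow_le_of_block two_pow_half_mul_le pinnedRows unflat flat_unflat
    pinnedRows_emb_exactTilted corVirtualHardN_of_pinnedRowsLaw zgen cubePt dotProduct_cubePt)

/-! ### §12f the RATE with a forced-out set `Z` of at most half the blocks -/

section DeadRate

variable {n k : ℕ}

/-- `3^m ≤ (r+1)·2^m` descends to every `m' ≤ m`. -/
theorem three_two_pow_mono {m m' r : ℕ} (hm : m' ≤ m) (h : 3 ^ m ≤ (r + 1) * 2 ^ m) : 3 ^ m' ≤ (r + 1) * 2 ^ m' := by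
  obtain ⟨d, rfl⟩ := Nat.exists_eq_add_of_le hm
  have h2 : 0 < 2 ^ d := Nat.two_pow_pos d
  have h23 : 2 ^ d ≤ 3 ^ d := Nat.pow_le_pow_left (by norm_num) d
  have h1 : 3 ^ m' * 2 ^ d ≤ (r + 1) * 2 ^ m' * 2 ^ d := by
    calc 3 ^ m' * 2 ^ d ≤ 3 ^ m' * 3 ^ d := Nat.mul_le_mul_left _ h23
      _ = 3 ^ (m' + d) := (pow_add 3 m' d).symm
      _ ≤ (r + 1) * 2 ^ (m' + d) := h
      _ = (r + 1) * 2 ^ m' * 2 ^ d := by rw [pow_add, mul_assoc]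
  exact Nat.le_of_mul_le_mul_right h1 h2

/-- ★★★ **TOUCH-Z-OR-SPARSE, RATE FORM**: blocks of size `s`, a forced-out set `Z` with `2|Z| ≤ n/s`; every nonzero entry of every pairwise
vertex difference in a column of `Z` or in a column set of size `< s` ⇒ `xc(COR + Q) > T c n` eventually (`Z = ∅`: `cor_add_sparseDiff_decided`). -/
theorem cor_add_touchOrSparse_decided (s c : ℕ) (hs : 0 < s) : ∃ n₀ : ℕ, ∀ n ≥ n₀, ∀ Z : Finset (Fin n), 2 * Z.card ≤ n / s →
    ∀ {ι : Type} [Fintype ι] [Nonempty ι] (Qm : ι → Matrix (Fin n) (Fin n) ℝ) (Vs : ι → ι → Finset (Fin n)),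
    (∀ j j' x y, (Qm j - Qm j') x y ≠ 0 → y ∈ Z ∨ y ∈ Vs j j') → (∀ j j', (Vs j j').card < s) → ∀ r : ℕ,
    HasEFOfSize (corPolytope n + convexHull ℝ (Set.range (fun j => flat (Qm j)))) r → T c n < r := by
  classical
  obtain ⟨n₀, hn₀⟩ := T_lt_of_block_div (s * 2) (by omega) c
  refine ⟨max n₀ s, fun n hn Z hZ ι _ _ Qm Vs hG hVs r hEF => hn₀ n (le_of_max_le_left hn) r ?_⟩
  have hns : s ≤ n := le_of_max_le_right hn
  let β := βstd hs hns
  let D : Finset (Fin (n / s)) := Z.image β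
  have hD : D.card ≤ Z.card := Finset.card_image_le
  have key := cor_add_touchOrSparse_bound (βstd_σstd hs hns) D Qm Vs
    (fun j j' x y h => (hG j j' x y h).imp_left fun hy => Finset.mem_image_of_mem β hy)
    (fun j j' i _ => lt_of_lt_of_le (hVs j j') (le_bsize_βstd hs hns i)) r hEF
  refine three_two_pow_mono ?_ key
  rw [← Nat.div_div_eq_div_mul]
  omega

end DeadRate

/-! ### §12g ★★★ COLUMN-HIT PASSENGERS (singleton live blocks, no block structure): `Z ∋` a nonzero column of every nonzero pairwise vertex
difference ⇒ `3^{n−|Z|} ≤ (xc+1)·2^{n−|Z|}`; few-vertex passengers (`2K² ≤ n`), `CUT_n` (`|Z| = 1`). -/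

section ColumnHit

variable {n : ℕ}

/-- ★★★ **COLUMN-HIT BOUND.** -/
theorem cor_add_bound_of_columnHit {ι : Type*} [Fintype ι] [Nonempty ι] (Qm : ι → Matrix (Fin n) (Fin n) ℝ) (Z : Finset (Fin n))
    (hZ : ∀ j j', Qm j ≠ Qm j' → ∃ x, ∃ y ∈ Z, (Qm j - Qm j') x y ≠ 0) (r : ℕ)
    (hEF : HasEFOfSize (corPolytope n + convexHull ℝ (Set.range (fun j => flat (Qm j)))) r) :
    3 ^ (n - Z.card) ≤ (r + 1) * 2 ^ (n - Z.card) :=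
  cor_add_bound_of_pairsReadD (β := id) (σ := id) (fun _ => rfl) Z Qm
    (fun j j' hne => by
      obtain ⟨x, y, hy, hxy⟩ := hZ j j' hne
      exact ⟨Es x y, Es_faceZeroD id Z (Or.inr hy), by rw [flat_Es_dotProduct_flat]; exact hxy⟩) r hEF

/-- rate form: `2|Z| ≤ n` ⇒ `xc > T c n` eventually. -/
theorem cor_add_columnHit_decided (c : ℕ) : ∃ n₀ : ℕ, ∀ n ≥ n₀, ∀ {ι : Type} [Fintype ι] [Nonempty ι]
    (Qm : ι → Matrix (Fin n) (Fin n) ℝ) (Z : Finset (Fin n)), 2 * Z.card ≤ n →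
    (∀ j j', Qm j ≠ Qm j' → ∃ x, ∃ y ∈ Z, (Qm j - Qm j') x y ≠ 0) → ∀ r : ℕ,
    HasEFOfSize (corPolytope n + convexHull ℝ (Set.range (fun j => flat (Qm j)))) r → T c n < r := by
  obtain ⟨n₀, hn₀⟩ := T_lt_of_block_div 2 (by norm_num) c
  refine ⟨n₀, fun n hn ι _ _ Qm Z hZ hread r hEF => hn₀ n hn r ?_⟩
  refine three_two_pow_mono ?_ (cor_add_bound_of_columnHit Qm Z hread r hEF)
  omega

/-- ★★★ **FEW-VERTEX PASSENGERS ARE DECIDED**: any passenger with `K` vertices, `2K² ≤ n`, of any shape (memo §2g (i), deterministic part). -/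
theorem cor_add_fewVertex_decided (c : ℕ) : ∃ n₀ : ℕ, ∀ n ≥ n₀, ∀ {ι : Type} [Fintype ι] [Nonempty ι]
    (Qm : ι → Matrix (Fin n) (Fin n) ℝ), 2 * Fintype.card ι ^ 2 ≤ n → ∀ r : ℕ,
    HasEFOfSize (corPolytope n + convexHull ℝ (Set.range (fun j => flat (Qm j)))) r → T c n < r := by
  classical
  obtain ⟨n₀, hn₀⟩ := cor_add_columnHit_decided c
  refine ⟨n₀, fun n hn ι _ _ Qm hK r hEF => ?_⟩
  -- one nonzero column per ordered pair of distinct vertices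
  have hcol : ∀ p : ι × ι, Qm p.1 ≠ Qm p.2 → ∃ x y, (Qm p.1 - Qm p.2) x y ≠ 0 := by
    intro p hne
    by_contra h
    push Not at h
    exact hne (sub_eq_zero.mp (Matrix.ext fun x y => by rw [h x y]; rfl))
  let col : ι × ι → Finset (Fin n) := fun p =>
    if h : Qm p.1 ≠ Qm p.2 then {(Classical.choose_spec (hcol p h)).choose} else ∅
  let Z : Finset (Fin n) := Finset.univ.biUnion col
  have hZcard : Z.card ≤ Fintype.card ι ^ 2 := by
    calc Z.card ≤ ∑ p : ι × ι, (col p).card := Finset.card_biUnion_le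
      _ ≤ ∑ _p : ι × ι, 1 := Finset.sum_le_sum fun p _ => by
          show (col p).card ≤ 1
          dsimp only [col]
          split_ifs
          · rw [Finset.card_singleton]
          · simp
      _ = Fintype.card ι ^ 2 := by simp [sq, Fintype.card_prod]
  refine hn₀ n hn Qm Z (by omega) (fun j j' hne => ?_) r hEF
  have h1 := (Classical.choose_spec (hcol (j, j') hne)).choose_spec
  refine ⟨Classical.choose (hcol (j, j') hne), (Classical.choose_spec (hcol (j, j') hne)).choose, ?_, h1⟩
  refine Finset.mem_biUnion.mpr ⟨(j, j'), Finset.mem_univ _, ?_⟩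
  show _ ∈ (if h : Qm (j, j').1 ≠ Qm (j, j').2 then _ else _)
  rw [dif_pos hne]
  exact Finset.mem_singleton_self _

/-- the cut matrices `δ(S)_{uv} = [u ∈ S ⊕ v ∈ S]`. -/
def cutMat (S : Finset (Fin n)) : Matrix (Fin n) (Fin n) ℝ := fun u v => if (u ∈ S ↔ v ∈ S) then 0 else 1

/-- a cut matrix is determined by any one of its columns. -/
theorem cutMat_eq_of_column {S S' : Finset (Fin n)} (y₀ : Fin n) (h : ∀ x, cutMat S x y₀ = cutMat S' x y₀) : cutMat S = cutMat S' := by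
  have h' : ∀ x, ((x ∈ S ↔ y₀ ∈ S) ↔ (x ∈ S' ↔ y₀ ∈ S')) := by
    intro x
    have hx := h x
    unfold cutMat at hx
    by_cases h1 : (x ∈ S ↔ y₀ ∈ S)
    · by_cases h2 : (x ∈ S' ↔ y₀ ∈ S')
      · exact iff_of_true h1 h2
      · rw [if_pos h1, if_neg h2] at hx; exact absurd hx zero_ne_one
    · by_cases h2 : (x ∈ S' ↔ y₀ ∈ S')
      · rw [if_neg h1, if_pos h2] at hx; exact absurd hx one_ne_zero
      · exact iff_of_false h1 h2
  have key : ∀ u v, ((u ∈ S ↔ v ∈ S) ↔ (u ∈ S' ↔ v ∈ S')) := fun u v => by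
    have hu := h' u
    have hv := h' v
    tauto
  ext u v
  unfold cutMat
  by_cases h1 : (u ∈ S ↔ v ∈ S)
  · rw [if_pos h1, if_pos ((key u v).mp h1)]
  · rw [if_neg h1, if_neg (fun h2 => h1 ((key u v).mpr h2))]

/-- ★★★ **`COR_n + CUT_n` is hard**: the cut polytope as passenger (`2ⁿ` vertices, dense differences) is decided with ONE dead coordinate
(memo §2g (ii)): `3^{n−1} ≤ (xc+1)·2^{n−1}`. -/
theorem cor_add_cut_bound (hn : 0 < n) (r : ℕ)
    (hEF : HasEFOfSize (corPolytope n + convexHull ℝ (Set.range (fun S : Finset (Fin n) => flat (cutMat S)))) r) :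
    3 ^ (n - 1) ≤ (r + 1) * 2 ^ (n - 1) := by
  classical
  have key := cor_add_bound_of_columnHit (fun S : Finset (Fin n) => cutMat S) {(⟨0, hn⟩ : Fin n)}
    (fun S S' hne => by
      by_contra h
      push Not at h
      apply hne
      apply cutMat_eq_of_column (⟨0, hn⟩ : Fin n)
      intro x
      have := h x ⟨0, hn⟩ (Finset.mem_singleton_self _)
      rw [Matrix.sub_apply] at this
      linarith) r hEF
  rwa [Finset.card_singleton] at key

end ColumnHit

/-! ### §12h ★★★ FUNCTION-GRAPH PASSENGERS (perfect matchings `PM(K_n)`, permutation / Birkhoff vertices, any subfamily): blocks of size `≥ 2`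
read every nonzero difference by a row move `E_{xy} − E_{xy'}` (a graph row has ONE `1`), so `3^k ≤ (r+1)·2^k`; rate `k = ⌊n/2⌋`. -/

section FuncGraph

variable {n k : ℕ}

/-- the graph matrix of a function: `[M u = v]` (a perfect matching `M` = fixed-point-free involution gives its adjacency matrix). -/
def graphMat (M : Fin n → Fin n) : Matrix (Fin n) (Fin n) ℝ := fun u v => if M u = v then 1 else 0

/-- with blocks of size `≥ 2`, every nonzero difference of two function-graph matrices is read by a face-zero row move. -/
theorem exists_faceZero_reads_graphMat (β : Fin n → Fin k) (h2 : ∀ i, 2 ≤ bsize β i) {M M' : Fin n → Fin n}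
    (hne : graphMat M ≠ graphMat M') : ∃ U, faceZero β U ∧ flat U ⬝ᵥ flat (graphMat M - graphMat M') ≠ 0 := by
  classical
  obtain ⟨x, hx⟩ : ∃ x, M x ≠ M' x := by
    by_contra h
    push Not at h
    exact hne (by unfold graphMat; ext u v; rw [h u])
  obtain ⟨y', hy'A, hy'ne⟩ : ∃ y' ∈ Finset.univ.filter (fun z => β z = β (M x)), y' ≠ M x := by
    by_contra h
    push Not at h
    have hsub : Finset.univ.filter (fun z => β z = β (M x)) ⊆ {M x} := fun z hz => Finset.mem_singleton.mpr (h z hz)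
    have := (Finset.card_le_card hsub).trans_eq (Finset.card_singleton _)
    exact absurd (h2 (β (M x))) (by unfold bsize; omega)
  have hβ : β y' = β (M x) := (Finset.mem_filter.mp hy'A).2
  refine ⟨Ed x (M x) y', Ed_faceZero β hβ.symm, ?_⟩
  rw [flat_Ed_dotProduct_flat, Matrix.sub_apply, Matrix.sub_apply]
  unfold graphMat
  rw [if_pos rfl, if_neg (Ne.symm hx), if_neg (Ne.symm hy'ne)]
  split_ifs <;> norm_num

/-- ★★★ **FUNCTION-GRAPH PASSENGERS ARE DECIDED** (any index family; `PM(K_n)`, Birkhoff / assignment vertices, TSP successor maps …). -/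
theorem cor_add_funcGraph_bound {β : Fin n → Fin k} {σ : Fin k → Fin n} (hβσ : ∀ i, β (σ i) = i) (h2 : ∀ i, 2 ≤ bsize β i)
    {ι : Type*} [Fintype ι] [Nonempty ι] (M : ι → (Fin n → Fin n)) (r : ℕ)
    (hEF : HasEFOfSize (corPolytope n + convexHull ℝ (Set.range (fun j => flat (graphMat (M j))))) r) :
    3 ^ k ≤ (r + 1) * 2 ^ k :=
  cor_add_bound_of_pairsRead hβσ (fun j => graphMat (M j)) (fun _ _ hne => exists_faceZero_reads_graphMat β h2 hne) r hEF

/-- ★★★ RATE: `COR(n) +` any family of function-graph matrices is decided by C′ — `T c n < r` eventually (`k = ⌊n/2⌋` standard blocks). -/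
theorem cor_add_funcGraph_decided (c : ℕ) : ∃ n₀ : ℕ, ∀ n ≥ n₀, ∀ {ι : Type} [Fintype ι] [Nonempty ι]
    (M : ι → (Fin n → Fin n)) (r : ℕ),
    HasEFOfSize (corPolytope n + convexHull ℝ (Set.range (fun j => flat (graphMat (M j))))) r → T c n < r := by
  obtain ⟨n₀, hn₀⟩ := T_lt_of_block_div 2 (by norm_num) c
  refine ⟨max n₀ 2, fun n hn ι _ _ M r hEF => hn₀ n (le_of_max_le_left hn) r ?_⟩
  have hns : 2 ≤ n := le_of_max_le_right hn
  exact cor_add_funcGraph_bound (βstd_σstd (by norm_num) hns) (le_bsize_βstd (by norm_num) hns) M r hEF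

end FuncGraph

end Summit.ValiantsHypothesis.ValiantsHypothesis.Theorems.FifoMatching.ExactPencil
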